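/-
Copyright (c) 2026 the pub-hodgecm-mathlib formalisation cell (harness21).  Prover seat hodgecm-mathlib-K2E3-p29 (g2): Track B «K2-LIT», hLiu418 = stmt-HodgeConjecture-24832;
socket #41, KIND W; LEAD F0P6-plan (g14) BATCH #128 (2) «(KW-fin)», desk K2E4-p10 (g9).  THEOREMS ONLY (no `def`, no `instance`, no notation, no named-fact hypothesis, no `sorry`).
-/
import Summits.HodgeConjecture.HodgeConjecture.Theorems.K2LiuSiegelEisensteinKindWFinitePlaces   -- ★ FILE 2c `prod_pow_absNorm_le_pow_finrank_natCast`, `prod_pow_absNorm_le_of_det_smul`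
import Summits.HodgeConjecture.HodgeConjecture.Theorems.K2LiuSiegelEisensteinKindWPresentation   -- ★ STAGE 2 currency (`ι X κT`, `mat ht Tfin Ffin`) + ★ `KindWInstance` heights
import Literature.NumberTheory.Automorphic.UnitaryGroupLocalFactors                             -- ★ `instFintypePlacesOver` (the fibre `{w ∣ v}` is a `Fintype`)
import HarnessLib

/-!
# Crux `HLiu418`, socket #41, KIND W — `K2LiuKindWFinitePartLettersOfRecord`: THE STAGE-2 PER-TERM FINITE LETTERS `hfsupp`, `hfsize` OF ★∕📤 `kindW_block_of_record`
# FROM PER-PLACE LETTERS IN LOCAL CURRENCY (level ∕ denominator exponents above one place `v`) — the local → global arithmetic, hypothesis-first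

Cell `hodgecm-mathlib`, crux item hLiu418 = `stmt-HodgeConjecture-24832` (helper lane `--supports … --as helper`, count-neutral), route of record `HCCMUnconditional`;
squad K2 ∕ K2Liu, road `K2_Liu`, socket #41 `sig_K2LiuSiegelEisensteinContinuation`, KIND W; LEAD F0P6-plan (g14) BATCH #128 (2), desk K2E4-p10 (g9).
THE POINT.  K2E4-p10's KW payer head `K2LiuSiegelEisensteinKindWOfRecord.kindW_block_of_record` takes the CONTINUED local letters `Finf`, `Ffin` BY VALUE (so does ★ (x-a) ed. 4
`…KindWEulerLocalLetters`), together with two STAGE-2 per-term FINITE letters in GLOBAL currency: the per-place SUPPORT letter `hfsupp` (defect datum `(T_δ, δ, k)`: «`F_{v,j} ≠ 0` forces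
`N(𝔭_w)^m ≤ N(𝔭_w)^{δ_w} H_w(h)^k ∧ |S_{ab}|_w ≤ q_w^m` at every `w ∣ v`») and the FINITE SIZE letter `hfsize` («`‖∏_{v ∈ T(S,h)} F_{v,j}‖ ≤ C ‖h‖^a (1 + τ S)^{N₂} D^{N₃}` for EVERY
admissible denominator `D` of `S`, locally uniformly in `s`»).  The per-place payers (★ Φ5 `K2LiuBadPlaceWhittakerEntire` ball form ∕ lattice support ∕ ball bound at the places of
`T(S,h)`; ★ (c1) `K2LiuLocalHeightLevelConjugation` for level-vs-height) speak LOCAL currency: the LEVEL of `h` at `w`, the DENOMINATOR EXPONENTS of `S` and of `S⁻¹` above `v`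
(Φ5's ball radius is `K₁ + 4·ord β + 2·ord β⁻¹`).  THIS FILE is the arithmetic from the local letters to the head's two letters, in ★ `K2LiuSiegelEisensteinKindWPresentation`'s
generic currency (index type `ι` with `mat : ι → M_n(L)`, point type `X` with `ht : X → GL_N(𝔸_L)`, `K`-finite index `κT`, places `v` of `L⁺` for the presentation, `w ∣ v` of `L` via
★ `UnitaryGroup.PlacesOver`):
* §1 tools — `∏_{v∈T} ∏_{w∣v} g(w) = ∏_{w∈T′} g(w)` (`prod_placesOver_eq_prod_biUnion`: distinct `v` have disjoint fibres); the valuation of a non-zero `ℤ`-integral element is `q_w^{−m}`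
  (`exists_valuation_eq_exp_neg`); `D·S` integral ⇒ `|S_{ab}|_w ≤ |D|_w⁻¹` (`valuation_le_of_den`); `S⁻¹ = D·adj(D S)∕det(D S)` ⇒ `|S⁻¹_{ab}|_w ≤ |det(D S)|_w⁻¹`
  (`valuation_inv_le_of_den`, adjugate of an integral matrix is integral); `∏_{w∈T′} H_w(g) ≤ N ‖g‖` (★ `finprod_localHeight_le` on a finite sub-product).
* §2 **`hfsupp_of_levelLetters`** — from a LEVEL function `lev : X → 𝔭 ↦ ℕ` with its height letter `N(𝔭_w)^{lev x w} ≤ N(𝔭_w)^{δ₀ w} H_w(ht x)^k` (`δ₀ = 0` off `T_{δ₀}`), a conductor defect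
  `c` (`= 0` off `T_c`), and the per-place support letter «`F_{v,j} i s x ≠ 0 ⇒ |mat i|_w ≤ q_w^{lev x w + c w}` at every `w ∣ v`»: the head's `hfsupp` BYTES with `δ := δ₀ + c`
  (`= 0` off `T_{δ₀} ∪ T_c`, `hdelta_eq_zero_off`), same `k`.
* §3 **`hfsize_of_placeLetters`** — from UNIFORM exponents `k₂ k₃`, a FIXED finite defect set `T_β`, and the per-place size letter, locally uniformly in `s`: «for every `dS, dA : 𝔭 ↦ ℕ` with
  `|mat i|_w ≤ q_w^{dS w}` and `|(mat i)⁻¹|_w ≤ q_w^{dA w}` above `v`: `‖F_{v,j} i s x‖ ≤ ∏_{w∣v} N(𝔭_w)^{β w} H_w(ht x)^{k₁} N(𝔭_w)^{k₂ dS w + k₃ dA w}`» (`β = 0` off `T_β`; `k₁`, `β` may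
  depend on the centre `z`): the head's `hfsize` BYTES for every admissible `D`, with `N₂ := n·[L:ℚ]·k₃`, `N₃ := [L:ℚ]·(k₂ + n·k₃)` — `dS := ord_w D`, `dA := ord_w det(D·mat i)`
  (`0` if `det = 0`), then ★ FILE 2c twice (`∏ N(𝔭_w)^{ord_w D} ≤ D^{[L:ℚ]}`, `∏ N(𝔭_w)^{ord_w det(D S)} ≤ (D^n n! (1+τ)^n)^{[L:ℚ]}`) and ★ `finprod_localHeight_le`.
[Shimura1997, §18.4 Prop. 18.14], [MoeglinWaldspurger1995, II.1.7, IV.1.9], [KudlaRallis1994, §2], [NeukirchANT1999, Ch. III §1], [BorelJacquet1979, §1.2].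
HONEST LABEL.  Count-neutral helper, closes no socket: `HC_CM` is proved only modulo the 7 printed citations (2 remaining named inputs: hLiu418 =
`stmt-HodgeConjecture-24832`, h413 = `stmt-HodgeConjecture-24833`) until rung 0 closes.
-/

set_option autoImplicit false
set_option linter.dupNamespace false -- the mandated namespace repeats `HodgeConjecture.HodgeConjecture`

noncomputable section

namespace Summit.HodgeConjecture.HodgeConjecture.Cruxes.HLiu418.K2LiuKindWFinitePartLettersOfRecord

open scoped BigOperators NNReal
-- `Classical` is needed to see the Mathlib normed-ring instances on `mixedSpace L` (note H5 of ★ `AdelicGLnGlue`) and for the `Finset.biUnion` over places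
open scoped Classical
open NumberField NumberField.mixedEmbedding IsDedekindDomain
open Literature.NumberTheory.Automorphic
open Summit.HodgeConjecture.HodgeConjecture.Cruxes.HLiu418.K2LiuSiegelEisensteinKindWInstance (finprod_localHeight_le two_le_absNorm)
open Summit.HodgeConjecture.HodgeConjecture.Cruxes.HLiu418.K2LiuSiegelEisensteinKindWFinitePlaces (prod_pow_absNorm_le_pow_finrank_natCast prod_pow_absNorm_le_of_det_smul)

variable (L : Type) [Field L] [NumberField L]

/-! ## §1 Tools: the fibres `w ∣ v`, valuations of integral elements, denominators of `S` and `S⁻¹`, heights on a finite set of places -/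

section Tools

/-- **`∏_{v∈T} ∏_{w∣v} g(w) = ∏_{w∈T′} g(w)`** with `T′ := ⋃_{v∈T} {w ∣ v}` as a `Finset` of places of `L` (distinct `v` have disjoint fibres: `w ∣ v ∧ w ∣ v′ ⇒ v = v′`).
[cite: NeukirchANT1999, Ch. I §8] -/
theorem prod_placesOver_eq_prod_biUnion (T : Finset (HeightOneSpectrum (𝓞 ↥(maximalRealSubfield L)))) (g : HeightOneSpectrum (𝓞 L) → ℝ) :
    ∏ v ∈ T, ∏ w : UnitaryGroup.PlacesOver L v, g w.1 =
      ∏ w ∈ T.biUnion (fun v => (Finset.univ : Finset (UnitaryGroup.PlacesOver L v)).map (Function.Embedding.subtype _)), g w := by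
  rw [Finset.prod_biUnion]
  · refine Finset.prod_congr rfl fun v _ => ?_
    rw [Finset.prod_map]
    rfl
  · intro v _ v' _ hne
    refine Finset.disjoint_left.2 fun w hw hw' => hne ?_
    obtain ⟨w₁, -, rfl⟩ := Finset.mem_map.1 hw
    obtain ⟨w₂, -, h₂⟩ := Finset.mem_map.1 hw'
    have h : w₂.1 = w₁.1 := h₂
    rw [← w₁.2, ← w₂.2, h]

/-- Membership in `T′`: `w ∈ T′ ↔ w.under ∈ T`. [cite: NeukirchANT1999, Ch. I §8] -/
theorem mem_biUnion_placesOver_iff (T : Finset (HeightOneSpectrum (𝓞 ↥(maximalRealSubfield L)))) (w : HeightOneSpectrum (𝓞 L)) :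
    w ∈ T.biUnion (fun v => (Finset.univ : Finset (UnitaryGroup.PlacesOver L v)).map (Function.Embedding.subtype _)) ↔
      w.under (𝓞 ↥(maximalRealSubfield L)) ∈ T := by
  constructor
  · intro hw
    obtain ⟨v, hv, hwv⟩ := Finset.mem_biUnion.1 hw
    obtain ⟨w₁, -, rfl⟩ := Finset.mem_map.1 hwv
    rw [show (Function.Embedding.subtype _ w₁ : HeightOneSpectrum (𝓞 L)) = w₁.1 from rfl, w₁.2]
    exact hv
  · intro hw
    refine Finset.mem_biUnion.2 ⟨_, hw, Finset.mem_map.2 ⟨⟨w, rfl⟩, Finset.mem_univ _, rfl⟩⟩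

/-- A `ℤ`-integral element of `L` has valuation `≤ 1` at every finite place. [cite: NeukirchANT1999, Ch. I §3] -/
theorem valuation_le_one_of_isIntegral (w : HeightOneSpectrum (𝓞 L)) {y : L} (hy : IsIntegral ℤ y) : w.valuation L y ≤ 1 := by
  set x : 𝓞 L := ⟨y, (mem_integralClosure_iff ℤ L).2 hy⟩ with hxdef
  have hxy : (x : L) = y := rfl
  rw [← hxy]
  exact HeightOneSpectrum.valuation_le_one w x

/-- **The valuation of a non-zero `ℤ`-integral element is `q_w^{−m}` for some `m ∈ ℕ`** (`= exp(log ·)`, `≤ 1`). [cite: NeukirchANT1999, Ch. I §3, Ch. II §3] -/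
theorem exists_valuation_eq_exp_neg (w : HeightOneSpectrum (𝓞 L)) {y : L} (hy : IsIntegral ℤ y) (hy0 : y ≠ 0) :
    ∃ m : ℕ, w.valuation L y = WithZero.exp (-(m : ℤ)) := by
  have h0 : w.valuation L y ≠ 0 := (Valuation.ne_zero_iff _).2 hy0
  have h1 := valuation_le_one_of_isIntegral L w hy
  set k : ℤ := WithZero.log (w.valuation L y) with hk
  have hval : w.valuation L y = WithZero.exp k := (WithZero.exp_log h0).symm
  have hk0 : k ≤ 0 := by
    rw [hval, ← WithZero.exp_zero, WithZero.exp_le_exp] at h1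
    exact h1
  refine ⟨(-k).toNat, ?_⟩
  rw [hval, Int.toNat_of_nonneg (by omega), neg_neg]

/-- **`D·S` integral ⇒ `|S_{ab}|_w ≤ |D|_w⁻¹`**: if `|D|_w = q_w^{−m}` and `D · y` is `ℤ`-integral then `|y|_w ≤ q_w^{m}`. [cite: NeukirchANT1999, Ch. II §3] -/
theorem valuation_le_of_den (w : HeightOneSpectrum (𝓞 L)) {D y : L} {m : ℕ} (hD : w.valuation L D = WithZero.exp (-(m : ℤ))) (hy : IsIntegral ℤ (D * y)) :
    w.valuation L y ≤ WithZero.exp (m : ℤ) := by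
  have h1 : w.valuation L (D * y) ≤ 1 := valuation_le_one_of_isIntegral L w hy
  rw [map_mul, hD] at h1
  have hD0 : WithZero.exp (-(m : ℤ)) ≠ 0 := WithZero.coe_ne_zero
  calc w.valuation L y = WithZero.exp (m : ℤ) * (WithZero.exp (-(m : ℤ)) * w.valuation L y) := by
        rw [← mul_assoc, ← WithZero.exp_add, add_neg_cancel, WithZero.exp_zero, one_mul]
    _ ≤ WithZero.exp (m : ℤ) * 1 := mul_le_mul' le_rfl h1
    _ = WithZero.exp (m : ℤ) := mul_one _

omit [NumberField L] in
/-- The adjugate of a matrix with `ℤ`-integral entries has `ℤ`-integral entries (each entry is a determinant of an updated matrix). [cite: NeukirchANT1999, Ch. I §2] -/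
theorem isIntegral_adjugate {n : ℕ} (A : Matrix (Fin n) (Fin n) L) (hA : ∀ a b, IsIntegral ℤ (A a b)) (a b : Fin n) : IsIntegral ℤ (A.adjugate a b) := by
  rw [Matrix.adjugate_apply]
  refine IsIntegral.det fun i j => ?_
  rw [Matrix.updateRow_apply]
  split_ifs with h
  · rw [Pi.single_apply]
    split_ifs
    · exact isIntegral_one
    · exact isIntegral_zero
  · exact hA i j

omit [NumberField L] in
/-- **`S⁻¹ = D·adj(D S)∕det(D S)`, entrywise**: for `det S ≠ 0`, `S⁻¹_{ab} · det(D • S) = D · adj(D • S)_{ab}`. [cite: NeukirchANT1999, Ch. I §2] -/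
theorem inv_apply_mul_det_smul {n : ℕ} (S : Matrix (Fin n) (Fin n) L) (hdet : S.det ≠ 0) (D : L) (a b : Fin n) :
    S⁻¹ a b * ((D • S).det) = D * (D • S).adjugate a b := by
  have hn : n - 1 + 1 = n := Nat.sub_add_cancel (Nat.succ_le_of_lt (Fin.pos a))
  rw [Matrix.inv_def, Ring.inverse_eq_inv', Matrix.smul_apply, Matrix.det_smul, Matrix.adjugate_smul, Matrix.smul_apply, Fintype.card_fin, smul_eq_mul,
    smul_eq_mul]
  have hDn : D ^ n = D * D ^ (n - 1) := by
    conv_lhs => rw [← hn, pow_succ']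
  rw [hDn]
  field_simp

/-- **`|S⁻¹_{ab}|_w ≤ |det(D S)|_w⁻¹`**: for `det S ≠ 0`, `D` and `D·S` integral over `ℤ`, and `|det(D • S)|_w = q_w^{−m}`: `|S⁻¹_{ab}|_w ≤ q_w^{m}`.
[cite: NeukirchANT1999, Ch. II §3] [cite: Shimura1997, §18.4 Prop. 18.14] -/
theorem valuation_inv_le_of_den (w : HeightOneSpectrum (𝓞 L)) {n : ℕ} (S : Matrix (Fin n) (Fin n) L) (hdet : S.det ≠ 0) {D : L} (hDi : IsIntegral ℤ D)
    (hDS : ∀ a b, IsIntegral ℤ (D * S a b)) {m : ℕ} (hm : w.valuation L (D • S).det = WithZero.exp (-(m : ℤ))) (a b : Fin n) :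
    w.valuation L (S⁻¹ a b) ≤ WithZero.exp (m : ℤ) := by
  have hadj : IsIntegral ℤ ((D • S).adjugate a b) :=
    isIntegral_adjugate L (D • S) (fun a b => by rw [Matrix.smul_apply, smul_eq_mul]; exact hDS a b) a b
  have h1 : w.valuation L (S⁻¹ a b * (D • S).det) ≤ 1 := by
    rw [inv_apply_mul_det_smul L S hdet D a b]
    exact valuation_le_one_of_isIntegral L w (hDi.mul hadj)
  rw [map_mul, hm] at h1
  calc w.valuation L (S⁻¹ a b) = (w.valuation L (S⁻¹ a b) * WithZero.exp (-(m : ℤ))) * WithZero.exp (m : ℤ) := by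
        rw [mul_assoc, ← WithZero.exp_add, neg_add_cancel, WithZero.exp_zero, mul_one]
    _ ≤ 1 * WithZero.exp (m : ℤ) := mul_le_mul' h1 le_rfl
    _ = WithZero.exp (m : ℤ) := one_mul _

variable {N : ℕ} [NeZero N]

/-- **`∏_{w∈T′} H_w(g) ≤ N · ‖g‖`** for every finite set `T′` of finite places (`H_w ≥ 1`, so a finite sub-product of `∏_w H_w` is at most the full finite product ★
`finprod_localHeight_le`). [cite: BorelJacquet1979, §1.2] [cite: MoeglinWaldspurger1995, I.2.2] -/
theorem prod_localHeight_le (T' : Finset (HeightOneSpectrum (𝓞 L))) (g : GL (Fin N) (AdeleRing (𝓞 L) L)) :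
    ∏ w ∈ T', (GLn.localHeight N L w g : ℝ) ≤ N * adelicHeightGL N L g := by
  have hfin : Function.HasFiniteMulSupport fun w => (GLn.localHeight N L w g : ℝ) := GLn.hasFiniteMulSupport_localHeight g
  have h1 : ∀ w, (1 : ℝ) ≤ (GLn.localHeight N L w g : ℝ) := fun w => by exact_mod_cast GLn.one_le_localHeight w g
  have hsub : ∏ w ∈ T', (GLn.localHeight N L w g : ℝ) ≤ ∏ w ∈ T' ∪ hfin.toFinset, (GLn.localHeight N L w g : ℝ) :=
    Finset.prod_le_prod_of_subset_of_one_le Finset.subset_union_left (fun w _ => zero_le_one.trans (h1 w)) fun w _ _ => h1 w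
  have heq : ∏ w ∈ T' ∪ hfin.toFinset, (GLn.localHeight N L w g : ℝ) = ∏ᶠ w, (GLn.localHeight N L w g : ℝ) := by
    refine (finprod_eq_prod_of_mulSupport_subset _ fun w hw => ?_).symm
    exact Finset.mem_coe.2 (Finset.mem_union_right _ (hfin.mem_toFinset.2 hw))
  rw [heq] at hsub
  exact hsub.trans (finprod_localHeight_le L g)

end Tools

/-! ## §2 `hfsupp` from LEVEL letters -/

section Supp

variable {N : ℕ} {n : ℕ}

omit [NumberField L] in
/-- the combined defect `δ₀ + c` vanishes off `T_{δ₀} ∪ T_c`. [cite: Shimura1997, §18.4 Prop. 18.14] -/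
theorem hdelta_eq_zero_off (Tδ₀ Tc : Finset (HeightOneSpectrum (𝓞 L))) (δ₀ c : HeightOneSpectrum (𝓞 L) → ℕ) (hδ₀ : ∀ w ∉ Tδ₀, δ₀ w = 0) (hc : ∀ w ∉ Tc, c w = 0) :
    ∀ w ∉ Tδ₀ ∪ Tc, (δ₀ + c) w = 0 := fun w hw => by
  rw [Finset.notMem_union] at hw
  rw [Pi.add_apply, hδ₀ w hw.1, hc w hw.2]

/-- **THE HEAD's `hfsupp` FROM LEVEL LETTERS.**  INPUT: a level function `lev : X → 𝔭 ↦ ℕ` with its height letter `N(𝔭_w)^{lev x w} ≤ N(𝔭_w)^{δ₀ w} · H_w(ht x)^k` (★ (c1) currency), a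
conductor defect `c`, and the per-place SUPPORT letter in level currency «`F_{v,j} i s x ≠ 0` (`v ∈ T i x`, `0 < re s`) ⇒ `|mat i_{ab}|_w ≤ q_w^{lev x w + c w}` at every `w ∣ v`».
OUTPUT: the head's `hfsupp` bytes (★ `sloc_of_presentation`'s hypothesis) with `δ := δ₀ + c`, witness `m := lev x w + c w`.
[cite: Shimura1997, §18.4 Prop. 18.14] [cite: KudlaRallis1994, §2] [cite: BorelJacquet1979, §1.2] -/
theorem hfsupp_of_levelLetters {ι X κT : Type*}
    (mat : ι → Matrix (Fin n) (Fin n) L) (ht : X → GL (Fin N) (AdeleRing (𝓞 L) L))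
    (Tfin : ι → X → Finset (HeightOneSpectrum (𝓞 ↥(maximalRealSubfield L))))
    (Ffin : HeightOneSpectrum (𝓞 ↥(maximalRealSubfield L)) → κT → ι → ℂ → X → ℂ)
    (lev : X → HeightOneSpectrum (𝓞 L) → ℕ) (δ₀ : HeightOneSpectrum (𝓞 L) → ℕ) (k : ℕ)
    (hlev : ∀ (x : X) (w : HeightOneSpectrum (𝓞 L)),
      ((Ideal.absNorm w.asIdeal : ℕ) : ℝ) ^ lev x w ≤ ((Ideal.absNorm w.asIdeal : ℕ) : ℝ) ^ δ₀ w * (GLn.localHeight N L w (ht x) : ℝ) ^ k)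
    (c : HeightOneSpectrum (𝓞 L) → ℕ)
    (hsuppLoc : ∀ (v : HeightOneSpectrum (𝓞 ↥(maximalRealSubfield L))) (j : κT) (i : ι) (s : ℂ) (x : X), v ∈ Tfin i x → 0 < s.re → Ffin v j i s x ≠ 0 →
      ∀ (w : UnitaryGroup.PlacesOver L v) (a b : Fin n), Valued.v (((mat i a b : L)) : w.1.adicCompletion L) ≤ WithZero.exp (((lev x w.1 + c w.1 : ℕ) : ℤ))) :
    ∀ (v : HeightOneSpectrum (𝓞 ↥(maximalRealSubfield L))) (j : κT) (i : ι) (s : ℂ) (x : X), v ∈ Tfin i x → 0 < s.re → Ffin v j i s x ≠ 0 →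
      ∀ w : UnitaryGroup.PlacesOver L v, ∃ m : ℕ,
        ((Ideal.absNorm w.1.asIdeal : ℕ) : ℝ) ^ m ≤ ((Ideal.absNorm w.1.asIdeal : ℕ) : ℝ) ^ (δ₀ + c) w.1 * (GLn.localHeight N L w.1 (ht x) : ℝ) ^ k ∧
          ∀ a b, Valued.v (((mat i a b : L)) : w.1.adicCompletion L) ≤ WithZero.exp (m : ℤ) := by
  intro v j i s x hv hs hF w
  refine ⟨lev x w.1 + c w.1, ?_, fun a b => hsuppLoc v j i s x hv hs hF w a b⟩
  have hq : (0 : ℝ) ≤ ((Ideal.absNorm w.1.asIdeal : ℕ) : ℝ) := Nat.cast_nonneg _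
  rw [pow_add, Pi.add_apply, pow_add]
  calc ((Ideal.absNorm w.1.asIdeal : ℕ) : ℝ) ^ lev x w.1 * ((Ideal.absNorm w.1.asIdeal : ℕ) : ℝ) ^ c w.1
      ≤ (((Ideal.absNorm w.1.asIdeal : ℕ) : ℝ) ^ δ₀ w.1 * (GLn.localHeight N L w.1 (ht x) : ℝ) ^ k) * ((Ideal.absNorm w.1.asIdeal : ℕ) : ℝ) ^ c w.1 :=
        mul_le_mul_of_nonneg_right (hlev x w.1) (pow_nonneg hq _)
    _ = _ := by ring

end Supp

/-! ## §3 `hfsize` from per-place SIZE letters (denominator exponents of `S` and `S⁻¹`, level heights, a fixed defect set) -/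

section Size

variable {N : ℕ} [NeZero N] {n : ℕ}

/-- **THE HEAD's `hfsize` FROM PER-PLACE SIZE LETTERS.**  INPUT: `τ i ≥ ‖(ι_∞ (mat i)_{ab})‖`; UNIFORM exponents `k₂, k₃`; a FIXED finite defect set `T_β`; and, locally uniformly near each `z`
with `0 < re z` (radius `r`, height exponent `k₁`, defects `β` supported on `T_β`), the per-place SIZE letter in LOCAL currency: for all `dS, dA : 𝔭 ↦ ℕ` with
`|mat i_{ab}|_w ≤ q_w^{dS w}` and `|(mat i)⁻¹_{ab}|_w ≤ q_w^{dA w}` at every `w ∣ v`,  `‖F_{v,j} i s x‖ ≤ ∏_{w∣v} N(𝔭_w)^{β w} · H_w(ht x)^{k₁} · N(𝔭_w)^{k₂ dS w + k₃ dA w}`.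
OUTPUT: the head's `hfsize` bytes for EVERY admissible `D` (`D ≥ 1`, `D · mat i` integral over `ℤ`), `N₂ := n·[L:ℚ]·k₃`, `N₃ := [L:ℚ]·(k₂ + n·k₃)`:
`‖∏_{v∈T i x} F_{v,j} i s x‖ ≤ C ‖ht x‖^a (1 + τ i)^{N₂} D^{N₃}` — `dS := ord_w D`, `dA := ord_w det(D·mat i)` (`0` if `det = 0`), ★ FILE 2c twice, ★ `finprod_localHeight_le`.
[cite: Shimura1997, §18.4 Prop. 18.14] [cite: MoeglinWaldspurger1995, IV.1.9] [cite: NeukirchANT1999, Ch. III §1] [cite: BorelJacquet1979, §1.2] -/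
theorem hfsize_of_placeLetters {ι X κT : Type*}
    (mat : ι → Matrix (Fin n) (Fin n) L) (ht : X → GL (Fin N) (AdeleRing (𝓞 L) L))
    (Tfin : ι → X → Finset (HeightOneSpectrum (𝓞 ↥(maximalRealSubfield L))))
    (Ffin : HeightOneSpectrum (𝓞 ↥(maximalRealSubfield L)) → κT → ι → ℂ → X → ℂ)
    (τ : ι → ℝ) (hτ : ∀ i, ‖fun a b => mixedEmbedding L (mat i a b)‖ ≤ τ i)
    (k₂ k₃ : ℕ) (Tβ : Finset (HeightOneSpectrum (𝓞 L)))
    (hsizeLoc : ∀ z : ℂ, 0 < z.re → ∃ (r : ℝ) (k₁ : ℕ) (β : HeightOneSpectrum (𝓞 L) → ℕ), 0 < r ∧ (∀ w ∉ Tβ, β w = 0) ∧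
      ∀ (j : κT) (i : ι) (s : ℂ), dist s z < r → ∀ (x : X) (v : HeightOneSpectrum (𝓞 ↥(maximalRealSubfield L))), v ∈ Tfin i x →
      ∀ (dS dA : HeightOneSpectrum (𝓞 L) → ℕ),
        (∀ (w : UnitaryGroup.PlacesOver L v) (a b : Fin n), Valued.v (((mat i a b : L)) : w.1.adicCompletion L) ≤ WithZero.exp ((dS w.1 : ℕ) : ℤ)) →
        (∀ (w : UnitaryGroup.PlacesOver L v) (a b : Fin n), Valued.v ((((mat i)⁻¹ a b : L)) : w.1.adicCompletion L) ≤ WithZero.exp ((dA w.1 : ℕ) : ℤ)) →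
        ‖Ffin v j i s x‖ ≤ ∏ w : UnitaryGroup.PlacesOver L v,
          ((Ideal.absNorm w.1.asIdeal : ℕ) : ℝ) ^ β w.1 * (GLn.localHeight N L w.1 (ht x) : ℝ) ^ k₁ *
            ((Ideal.absNorm w.1.asIdeal : ℕ) : ℝ) ^ (k₂ * dS w.1 + k₃ * dA w.1)) :
    ∀ z : ℂ, 0 < z.re → ∃ C a r : ℝ, 0 ≤ C ∧ 0 ≤ a ∧ 0 < r ∧ ∀ (j : κT) (i : ι) (s : ℂ), dist s z < r → ∀ (x : X) (D : ℕ), 1 ≤ D →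
      (∀ a b, IsIntegral ℤ ((D : L) * mat i a b)) →
      ‖∏ v ∈ Tfin i x, Ffin v j i s x‖ ≤ C * adelicHeightGL N L (ht x) ^ a * (1 + τ i) ^ (n * Module.finrank ℚ L * k₃) *
        (D : ℝ) ^ (Module.finrank ℚ L * (k₂ + n * k₃)) := by
  intro z hz
  obtain ⟨r, k₁, β, hr, hβ, hloc⟩ := hsizeLoc z hz
  -- positivity bookkeeping
  have hq0 : ∀ w : HeightOneSpectrum (𝓞 L), (0 : ℝ) ≤ ((Ideal.absNorm w.asIdeal : ℕ) : ℝ) := fun w => Nat.cast_nonneg _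
  have hq1 : ∀ w : HeightOneSpectrum (𝓞 L), (1 : ℝ) ≤ ((Ideal.absNorm w.asIdeal : ℕ) : ℝ) := fun w => by
    have h2 := two_le_absNorm L w
    exact_mod_cast (show 1 ≤ Ideal.absNorm w.asIdeal by omega)
  have hH1 : ∀ (x : X) (w : HeightOneSpectrum (𝓞 L)), (1 : ℝ) ≤ (GLn.localHeight N L w (ht x) : ℝ) := fun x w => by exact_mod_cast GLn.one_le_localHeight w (ht x)
  have hN : (0 : ℝ) ≤ N := Nat.cast_nonneg N
  set Cβ : ℝ := ∏ w ∈ Tβ, ((Ideal.absNorm w.asIdeal : ℕ) : ℝ) ^ β w with hCβ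
  have hCβ0 : 0 ≤ Cβ := Finset.prod_nonneg fun w _ => pow_nonneg (hq0 w) _
  set d : ℕ := Module.finrank ℚ L with hd
  refine ⟨Cβ * (N : ℝ) ^ k₁ * ((n.factorial : ℝ)) ^ (d * k₃), k₁, r, by positivity, Nat.cast_nonneg k₁, hr, fun j i s hs x D hD hDint => ?_⟩
  have hτ0 : 0 ≤ τ i := (norm_nonneg _).trans (hτ i)
  have hD0L : (D : L) ≠ 0 := by exact_mod_cast (show D ≠ 0 by omega)
  have hDi : IsIntegral ℤ ((D : L)) := by
    have h : IsIntegral ℤ (algebraMap ℤ L (D : ℤ)) := isIntegral_algebraMap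
    rwa [map_natCast] at h
  -- `dS := ord_w D`
  choose mD hmD using fun w : HeightOneSpectrum (𝓞 L) => exists_valuation_eq_exp_neg L w hDi hD0L
  have hdS : ∀ (v : HeightOneSpectrum (𝓞 ↥(maximalRealSubfield L))) (w : UnitaryGroup.PlacesOver L v) (a b : Fin n),
      Valued.v (((mat i a b : L)) : w.1.adicCompletion L) ≤ WithZero.exp ((mD w.1 : ℕ) : ℤ) := fun v w a b => by
    rw [HeightOneSpectrum.valuedAdicCompletion_eq_valuation']
    exact valuation_le_of_den L w.1 (hmD w.1) (hDint a b)
  -- `dA := ord_w det(D • mat i)` (`0` if `det (mat i) = 0`)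
  have hA : ∃ mA : HeightOneSpectrum (𝓞 L) → ℕ,
      (∀ (v : HeightOneSpectrum (𝓞 ↥(maximalRealSubfield L))) (w : UnitaryGroup.PlacesOver L v) (a b : Fin n),
        Valued.v ((((mat i)⁻¹ a b : L)) : w.1.adicCompletion L) ≤ WithZero.exp ((mA w.1 : ℕ) : ℤ)) ∧
      ∀ T' : Finset (HeightOneSpectrum (𝓞 L)), ∏ w ∈ T', ((Ideal.absNorm w.asIdeal : ℕ) : ℝ) ^ mA w ≤ ((D : ℝ) ^ n * ((n.factorial : ℝ) * (1 + τ i) ^ n)) ^ d := by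
    by_cases hdet : (mat i).det = 0
    · refine ⟨fun _ => 0, fun v w a b => ?_, fun T' => ?_⟩
      · rw [Matrix.nonsing_inv_apply_not_isUnit _ (by rw [hdet]; exact not_isUnit_zero), Matrix.zero_apply]
        simp
      · simp only [pow_zero, Finset.prod_const_one]
        have h1 : (1 : ℝ) ≤ (D : ℝ) ^ n * ((n.factorial : ℝ) * (1 + τ i) ^ n) := by
          have hD1 : (1 : ℝ) ≤ D := by exact_mod_cast hD
          have hf1 : (1 : ℝ) ≤ n.factorial := by exact_mod_cast Nat.one_le_iff_ne_zero.2 (Nat.factorial_ne_zero n)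
          exact one_le_mul_of_one_le_of_one_le (one_le_pow₀ hD1) (one_le_mul_of_one_le_of_one_le hf1 (one_le_pow₀ (by linarith)))
        exact one_le_pow₀ h1
    · have hDSi : IsIntegral ℤ (((D : L) • mat i).det) :=
        IsIntegral.det fun a b => by rw [Matrix.smul_apply, smul_eq_mul]; exact hDint a b
      have hDS0 : ((D : L) • mat i).det ≠ 0 := by
        rw [Matrix.det_smul, Fintype.card_fin]; exact mul_ne_zero (pow_ne_zero _ hD0L) hdet
      choose mA hmA using fun w : HeightOneSpectrum (𝓞 L) => exists_valuation_eq_exp_neg L w hDSi hDS0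
      refine ⟨mA, fun v w a b => ?_, fun T' => ?_⟩
      · rw [HeightOneSpectrum.valuedAdicCompletion_eq_valuation']
        exact valuation_inv_le_of_den L w.1 (mat i) hdet hDi (hDint) (hmA w.1) a b
      · refine prod_pow_absNorm_le_of_det_smul L (mat i) hdet hD hDint (hτ i) T' mA fun w _ => ?_
        rw [HeightOneSpectrum.valuedAdicCompletion_eq_valuation', hmA w]
  obtain ⟨mA, hdA, hAprod⟩ := hA
  -- the finite set of places `T′ = {w ∣ v : v ∈ T i x}`
  set T' : Finset (HeightOneSpectrum (𝓞 L)) :=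
    (Tfin i x).biUnion (fun v => (Finset.univ : Finset (UnitaryGroup.PlacesOver L v)).map (Function.Embedding.subtype _)) with hT'
  -- the place-by-place bound and the reindexing
  have hper : ∀ v ∈ Tfin i x, ‖Ffin v j i s x‖ ≤ ∏ w : UnitaryGroup.PlacesOver L v,
      ((Ideal.absNorm w.1.asIdeal : ℕ) : ℝ) ^ β w.1 * (GLn.localHeight N L w.1 (ht x) : ℝ) ^ k₁ *
        ((Ideal.absNorm w.1.asIdeal : ℕ) : ℝ) ^ (k₂ * mD w.1 + k₃ * mA w.1) := fun v hv =>
    hloc j i s hs x v hv mD mA (hdS v) (hdA v)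
  have hstep : ‖∏ v ∈ Tfin i x, Ffin v j i s x‖ ≤ ∏ w ∈ T', ((Ideal.absNorm w.asIdeal : ℕ) : ℝ) ^ β w * (GLn.localHeight N L w (ht x) : ℝ) ^ k₁ *
      ((Ideal.absNorm w.asIdeal : ℕ) : ℝ) ^ (k₂ * mD w + k₃ * mA w) := by
    rw [norm_prod, hT', ← prod_placesOver_eq_prod_biUnion L (Tfin i x)
      (fun w => ((Ideal.absNorm w.asIdeal : ℕ) : ℝ) ^ β w * (GLn.localHeight N L w (ht x) : ℝ) ^ k₁ * ((Ideal.absNorm w.asIdeal : ℕ) : ℝ) ^ (k₂ * mD w + k₃ * mA w))]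
    exact Finset.prod_le_prod (fun v _ => norm_nonneg _) hper
  -- split the product into the four factors
  have hsplit : ∏ w ∈ T', ((Ideal.absNorm w.asIdeal : ℕ) : ℝ) ^ β w * (GLn.localHeight N L w (ht x) : ℝ) ^ k₁ *
        ((Ideal.absNorm w.asIdeal : ℕ) : ℝ) ^ (k₂ * mD w + k₃ * mA w) =
      (∏ w ∈ T', ((Ideal.absNorm w.asIdeal : ℕ) : ℝ) ^ β w) * (∏ w ∈ T', (GLn.localHeight N L w (ht x) : ℝ)) ^ k₁ *
        ((∏ w ∈ T', ((Ideal.absNorm w.asIdeal : ℕ) : ℝ) ^ mD w) ^ k₂ * (∏ w ∈ T', ((Ideal.absNorm w.asIdeal : ℕ) : ℝ) ^ mA w) ^ k₃) := by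
    have hpt : ∀ w : HeightOneSpectrum (𝓞 L), ((Ideal.absNorm w.asIdeal : ℕ) : ℝ) ^ β w * (GLn.localHeight N L w (ht x) : ℝ) ^ k₁ *
          ((Ideal.absNorm w.asIdeal : ℕ) : ℝ) ^ (k₂ * mD w + k₃ * mA w) =
        ((Ideal.absNorm w.asIdeal : ℕ) : ℝ) ^ β w * ((GLn.localHeight N L w (ht x) : ℝ) ^ k₁ *
          ((((Ideal.absNorm w.asIdeal : ℕ) : ℝ) ^ mD w) ^ k₂ * (((Ideal.absNorm w.asIdeal : ℕ) : ℝ) ^ mA w) ^ k₃)) := fun w => by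
      rw [pow_add, pow_mul, pow_mul]; ring
    rw [Finset.prod_congr rfl fun w _ => hpt w, Finset.prod_mul_distrib, Finset.prod_mul_distrib, Finset.prod_mul_distrib, Finset.prod_pow, Finset.prod_pow,
      Finset.prod_pow]
    ring
  -- factor 1: the defects, on the fixed set `T_β`
  have hF1 : ∏ w ∈ T', ((Ideal.absNorm w.asIdeal : ℕ) : ℝ) ^ β w ≤ Cβ := by
    have heq : ∏ w ∈ T', ((Ideal.absNorm w.asIdeal : ℕ) : ℝ) ^ β w = ∏ w ∈ T' ∩ Tβ, ((Ideal.absNorm w.asIdeal : ℕ) : ℝ) ^ β w := by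
      refine (Finset.prod_subset Finset.inter_subset_left fun w hw hw' => ?_).symm
      have hwβ : w ∉ Tβ := fun h => hw' (Finset.mem_inter.2 ⟨hw, h⟩)
      rw [hβ w hwβ, pow_zero]
    rw [heq, hCβ]
    exact Finset.prod_le_prod_of_subset_of_one_le Finset.inter_subset_right (fun w _ => pow_nonneg (hq0 w) _) fun w _ _ => one_le_pow₀ (hq1 w)
  -- factor 2: the heights
  have hF2 : (∏ w ∈ T', (GLn.localHeight N L w (ht x) : ℝ)) ^ k₁ ≤ (N : ℝ) ^ k₁ * adelicHeightGL N L (ht x) ^ (k₁ : ℝ) := by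
    rw [Real.rpow_natCast, ← mul_pow]
    exact pow_le_pow_left₀ (Finset.prod_nonneg fun w _ => zero_le_one.trans (hH1 x w)) (prod_localHeight_le L T' (ht x)) k₁
  -- factor 3: the denominators of `mat i` (★ FILE 2c at `x = D`)
  have hF3 : (∏ w ∈ T', ((Ideal.absNorm w.asIdeal : ℕ) : ℝ) ^ mD w) ^ k₂ ≤ ((D : ℝ) ^ d) ^ k₂ := by
    refine pow_le_pow_left₀ (Finset.prod_nonneg fun w _ => pow_nonneg (hq0 w) _) ?_ k₂
    refine prod_pow_absNorm_le_pow_finrank_natCast L hD T' mD fun w _ => ?_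
    rw [HeightOneSpectrum.valuedAdicCompletion_eq_valuation', hmD w]
  -- factor 4: the denominators of `(mat i)⁻¹` (★ FILE 2c at `x = det(D • mat i)`)
  have hF4 : (∏ w ∈ T', ((Ideal.absNorm w.asIdeal : ℕ) : ℝ) ^ mA w) ^ k₃ ≤ (((D : ℝ) ^ n * ((n.factorial : ℝ) * (1 + τ i) ^ n)) ^ d) ^ k₃ :=
    pow_le_pow_left₀ (Finset.prod_nonneg fun w _ => pow_nonneg (hq0 w) _) (hAprod T') k₃
  -- assemble
  have hP1 : 0 ≤ ∏ w ∈ T', ((Ideal.absNorm w.asIdeal : ℕ) : ℝ) ^ β w := Finset.prod_nonneg fun w _ => pow_nonneg (hq0 w) _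
  have hP2 : 0 ≤ (∏ w ∈ T', (GLn.localHeight N L w (ht x) : ℝ)) ^ k₁ := pow_nonneg (Finset.prod_nonneg fun w _ => zero_le_one.trans (hH1 x w)) _
  have hP3 : 0 ≤ (∏ w ∈ T', ((Ideal.absNorm w.asIdeal : ℕ) : ℝ) ^ mD w) ^ k₂ := pow_nonneg (Finset.prod_nonneg fun w _ => pow_nonneg (hq0 w) _) _
  have hP4 : 0 ≤ (∏ w ∈ T', ((Ideal.absNorm w.asIdeal : ℕ) : ℝ) ^ mA w) ^ k₃ := pow_nonneg (Finset.prod_nonneg fun w _ => pow_nonneg (hq0 w) _) _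
  have hHpos : 0 ≤ adelicHeightGL N L (ht x) ^ (k₁ : ℝ) := Real.rpow_nonneg (adelicHeightGL_nonneg (ht x)) _
  have hD0 : (0 : ℝ) ≤ D := Nat.cast_nonneg D
  calc ‖∏ v ∈ Tfin i x, Ffin v j i s x‖
      ≤ (∏ w ∈ T', ((Ideal.absNorm w.asIdeal : ℕ) : ℝ) ^ β w) * (∏ w ∈ T', (GLn.localHeight N L w (ht x) : ℝ)) ^ k₁ *
          ((∏ w ∈ T', ((Ideal.absNorm w.asIdeal : ℕ) : ℝ) ^ mD w) ^ k₂ * (∏ w ∈ T', ((Ideal.absNorm w.asIdeal : ℕ) : ℝ) ^ mA w) ^ k₃) := by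
        rw [← hsplit]; exact hstep
    _ ≤ Cβ * ((N : ℝ) ^ k₁ * adelicHeightGL N L (ht x) ^ (k₁ : ℝ)) * (((D : ℝ) ^ d) ^ k₂ * (((D : ℝ) ^ n * ((n.factorial : ℝ) * (1 + τ i) ^ n)) ^ d) ^ k₃) := by
        gcongr
    _ = Cβ * (N : ℝ) ^ k₁ * (n.factorial : ℝ) ^ (d * k₃) * adelicHeightGL N L (ht x) ^ (k₁ : ℝ) * (1 + τ i) ^ (n * d * k₃) * (D : ℝ) ^ (d * (k₂ + n * k₃)) := by
        ring

end Size

end Summit.HodgeConjecture.HodgeConjecture.Cruxes.HLiu418.K2LiuKindWFinitePartLettersOfRecord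

end
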